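import Mathlib
import HarnessLib

/-!
# A hyperbolic pair splits off a power series over any field (Greuel–Pfister 2025, Lemma 3.4)

Topic: `Literature/AlgebraicGeometry/Resolution` (formal singularity theory; cf. the formal Morse
lemma `NodalFormalMorse.lean`). NAMED FACT (grounder-vendored, D-0014), filed while grounding the
crux `Summit.ResolutionOfSingularities.ResolutionOfSingularities.Theses.WildCones.ClassicalRegimes`
(item `stmt-ResolutionOfSingularities-16884`, its `p = 2` conjunct: "a cleaned state of order 2 has
non-zero alternating polar form, a hyperbolic pair splits off over `κ[[u]]` (Morse modulo squares;
Greuel–Kröning 1990, Greuel–Pfister 2025), the dynamics of `z² + u₁u₂ + g(u'')` is the suspended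
dynamics of `z² + g(u'')`").

Greuel–Pfister (J. Algebra 689 (2026) 610–628 = arXiv:2507.17078, §3) print, for `K` ANY field
(Lemma 3.4 is characteristic-free; it is the existence half of the splitting lemma in
characteristic 2, Thm. 3.5, whose 2-jet normal form is Arf's Thm. 3.1):

> "**Lemma 3.4.** Let `K` be any field. The power series
> `f = ∑_{i odd, i=1}^{2l−1} (aᵢ xᵢ² + bᵢ xᵢ xᵢ₊₁ + aᵢ₊₁ xᵢ₊₁²) + ∑_{i=2l+1}^{n} dᵢ xᵢ² + h(x₁,…,xₙ)`
> in `K[[x₁,…,xₙ]]`, with `aᵢ, bᵢ, dᵢ ∈ K`, `bᵢ ≠ 0`, and `h ∈ 𝔪³`, is right equivalent (by a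
> coordinate change mapping `xᵢ ↦ xᵢ` for `i ≥ 2l+1`) to
> `∑_{i odd, i=1}^{2l−1} (aᵢ′ xᵢ² + xᵢ xᵢ₊₁ + aᵢ₊₁ xᵢ₊₁²) + ∑_{i=2l+1}^{n} dᵢ xᵢ² + h′(x_{2l+1},…,xₙ)`,
> with `aᵢ′ = aᵢ/bᵢ²` and `h′ ∈ ⟨x_{2l+1},…,xₙ⟩³`."

and (p. 3) "Two power series `f` and `g` in `K⟨x⟩` are called right equivalent (`f ∼ᵣ g`) if there
exists a local automorphism `φ` of `K⟨x⟩` such that `φ(f) = g`" (`K⟨x⟩ = K[[x]]` in the formal case).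

Vendored here: the case `l = 1` (ONE hyperbolic pair `x₀, x₁`; the remaining variables
`x₂,…,x_{n+1}` indexed by `Fin.addNat j 2`, `j : Fin n`), which is the printed lemma with `l = 1`
and is the case the route item uses. Rendering: the coordinate change is a `K`-algebra automorphism
`φ` of `MvPowerSeries (Fin (n+2)) K` (every such automorphism is local — it maps `xᵢ − c`, a unit
for `c ≠ 0`, to a unit, so `φ xᵢ ∈ 𝔪` — and is the substitution by the `φ xᵢ`, by `𝔪`-adic
continuity of local homomorphisms; so "local automorphism" = `≃ₐ[K]`); `h ∈ 𝔪³` is "every monomial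
with non-zero coefficient has degree `≥ 3`"; `h′ ∈ ⟨x₂,…⟩³ ⊂ K[[x₂,…]]` is "every monomial with
non-zero coefficient has degree `≥ 3` and exponent `0` in `x₀` and `x₁`".

What is NOT here: general `l` (iterate this lemma, or restate), the 2-jet normal form (Arf,
Thm. 3.1) needed to bring an arbitrary `f ∈ 𝔪²` with a non-degenerate pair to the displayed shape,
the uniqueness of the residual part (Thm. 3.5), and the compatibility of the splitting with the
point-blow-up dynamics of the route (not in print; recorded on the item).

References: G.-M. Greuel, G. Pfister, *The splitting lemma in any characteristic*, J. Algebra 689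
(2026) 610–628, arXiv:2507.17078, Lemma 3.4, Thm. 3.5 [GreuelPfister2026]; G.-M. Greuel,
H. Kröning, *Simple singularities in positive characteristic*, Math. Z. 203 (1990) 339–354
[GreuelKroning1990].
-/

noncomputable section

open MvPowerSeries

universe u

namespace Literature.AlgebraicGeometry.Resolution

/-- NAMED FACT — **Greuel–Pfister 2026 (arXiv 2025), Lemma 3.4 (case `l = 1`): a hyperbolic pair splits off
over any field.** For every field `K`, every `n`, all `a b c : K` with `b ≠ 0`, all `d : Fin n → K`
and every `h ∈ 𝔪³ ⊂ K[[x₀,…,x_{n+1}]]`, the power series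
`f = a x₀² + b x₀x₁ + c x₁² + ∑ⱼ dⱼ x_{j+2}² + h` is right equivalent, by a coordinate change
(`K`-algebra automorphism `φ`) with `φ xᵢ = xᵢ` for `i ≥ 2`, to
`(a/b²) x₀² + x₀x₁ + c x₁² + ∑ⱼ dⱼ x_{j+2}² + h′` with `h′` a power series in `x₂,…,x_{n+1}` only,
of order `≥ 3`. Users take `(h : GreuelPfister2026HyperbolicPairSplits)`. Grounds the `p = 2`
conjunct of `Summit.ResolutionOfSingularities.ResolutionOfSingularities.Theses.WildCones.ClassicalRegimes`.
[cite: GreuelPfister2026, Lemma 3.4 (arXiv:2507.17078 p. 9), case l = 1] -/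
def GreuelPfister2026HyperbolicPairSplits : Prop :=
  ∀ (K : Type u) [Field K] (n : ℕ) (a b c : K) (d : Fin n → K) (h : MvPowerSeries (Fin (n + 2)) K),
    b ≠ 0 →
    (∀ m : Fin (n + 2) →₀ ℕ, coeff m h ≠ 0 → 3 ≤ m.sum (fun _ e => e)) →
    ∃ (φ : MvPowerSeries (Fin (n + 2)) K ≃ₐ[K] MvPowerSeries (Fin (n + 2)) K)
      (h' : MvPowerSeries (Fin (n + 2)) K),
      (∀ j : Fin n, φ (X (j.addNat 2) : MvPowerSeries (Fin (n + 2)) K) = X (j.addNat 2)) ∧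
      (∀ m : Fin (n + 2) →₀ ℕ, coeff m h' ≠ 0 → 3 ≤ m.sum (fun _ e => e) ∧ m 0 = 0 ∧ m 1 = 0) ∧
      φ ((C a * X (0 : Fin (n + 2)) ^ 2 + C b * X (0 : Fin (n + 2)) * X (1 : Fin (n + 2)) +
          C c * X (1 : Fin (n + 2)) ^ 2 +
          (∑ j : Fin n, C (d j) * (X (j.addNat 2) : MvPowerSeries (Fin (n + 2)) K) ^ 2) + h :
            MvPowerSeries (Fin (n + 2)) K)) =
        (C (a / b ^ 2) * X (0 : Fin (n + 2)) ^ 2 + X (0 : Fin (n + 2)) * X (1 : Fin (n + 2)) +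
          C c * X (1 : Fin (n + 2)) ^ 2 +
          (∑ j : Fin n, C (d j) * (X (j.addNat 2) : MvPowerSeries (Fin (n + 2)) K) ^ 2) + h' :
            MvPowerSeries (Fin (n + 2)) K)

end Literature.AlgebraicGeometry.Resolution

end
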